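import Summits.PneNP.PneNP.Theorems.ChebyshevTracialDesignProfileExtrapolation
import Summits.PneNP.PneNP.Theorems.ChebyshevTracialDesignAPrioriBounds
import HarnessLib

/-!
# Cell pnp-psdrank, route `ChebyshevTracialDesign`: the TRACIAL profile polynomial — the level profile of every matrix-valued
# strategy of dimension `r` is a polynomial of degree `≤ D` at every odd level up to `r·√P_D`, and the crux at dimension `r` is the
# sign of its value at the virtual level

Harmonic backbone of the crux `TracialDecayExp20` (stmt-PneNP-19878), brick 20 (prover g7): the psd / all-`r` analogue of bricks
14–19 (MEMO-8 §4, HANDOFF prover g6 step (3)). Let `n` be even, `t = 2c'+1`, `2t + 2 ≤ n`, `D < t`, and `X : OddSet n → M_r(ℝ)`,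
`Y : PM_n → M_r(ℝ)` ANY matrix-valued strategies. The tracial level profile is `Φ_c := Σ_{(U,M) ∈ Q_c(t)} tr(X_U Y_M)`
(`= r·|Q_c|·levelProfile n t r X Y c`). Writing every entry `U ↦ (X_U)_{ab}` on the `t`-cuts in harmonic layers (lit
`exists_ladder_decomposition`) and truncating at degree `D` gives matrix coefficients `Q_A ∈ M_r(ℝ)`, `|A| ≤ D`, of the ENTRYWISE LOW PART
`X^{≤D}_U = Σ_{A ⊆ U} Q_A`; then (`tracial_profile_polynomial`) there is ONE real polynomial `P` of degree `≤ D` with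

  `P(0) = (1/|PM|)·Σ_M Σ_{|A|≤D} tr(Q_A Y_M)·knapsackMoment(|M|, t/2, |M[A]|) = (1/|PM|)·Σ_M Ẽ_M[tr(X^{≤D}_U Y_M)]`   and
  `|Φ_c − |Q_c|·P(c)| ≤ |Q_c| · √(P_D · (Σ_{|U|=t} ‖X_U‖_F²/C(n,t)) · (Σ_M ‖Y_M‖_F²/|PM|))`   at EVERY odd level `c = 2m+1 ≤ t`,

`P_D = Π_{i≤D/2}(2i+1)/(n−2i)`. For `0 ⪯ X_U, Y_M ⪯ I_r` the Frobenius sums are `≤ r·C(n,t)`, `≤ r·|PM|` (`frobenius_sq_le`), so the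
tail is `|Q_c|·r·√P_D` (`tracial_profile_polynomial_of_contractions`). With an exact design of degree `D` (levels `C`, `Σ|w_c| ≤ B`):
`|Σ_U Σ_M W(U,M)·tr(X_U Y_M) + P(0)| ≤ B·√(P_D·…)` (`tracial_value_truncation_explicit`), whence the ROUTE'S TWO-LAYER PLAN AT EVERY
DIMENSION as a tree theorem (`tracialValueLEAt_of_virtualNonneg`): if every tight-orthogonal psd rectangle of dimension `r` has
averaged virtual value `(1/|PM|)·Σ_M Ẽ_M[tr(X^{≤D}_U Y_M)] ≥ −ε·r`, then `TracialValueLEAt (levelWeight n t C w) (ε + B·√P_D) r` —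
(ATT) is discharged at every `r`, and what remains of `TracialDecayExp20` is exactly VIRTUAL NONNEGATIVITY of the entrywise-truncated
strategy against Grigoriev's knapsack pseudo-expectation, averaged over the matchings. [cite: Rothvoss2017, §2 (PDF p. 6)]
[cite: Grigoriev2001, Lemma 1.4 (PDF p. 8)] [cite: GriblingDelaatLaurent2019, §5] [cite: BrouwerHaemers2012, Prop. 4.3.2 (PDF p. 83)]
Stature: support/instrument. WHAT THIS IS NOT: not virtual nonnegativity itself (the open heart), nothing on psd rank by itself, no
P-vs-NP content. Supports stmt-PneNP-19878.
-/

set_option linter.dupNamespace false -- `Summit.PneNP.PneNP.…`: summit = sub-problem (D-0017)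

noncomputable section

namespace Summit.PneNP.PneNP.Theorems.ChebyshevTracialDesignTracialProfilePolynomial

open Finset Matrix Polynomial Literature.Barriers.PneNP Literature.Combinatorics.Optimization Literature.Computability.Complexity
open Literature.Combinatorics.AssociationSchemes Literature.Combinatorics.AssociationSchemes.JohnsonHarmonics
open Literature.Combinatorics.AssociationSchemes.JohnsonSpectrum
open Summit.PneNP.PneNP.Theorems.ChebyshevTracialDesignTightColumnSums
open Summit.PneNP.PneNP.Theorems.ChebyshevTracialDesignLevelTail
open Summit.PneNP.PneNP.Theorems.ChebyshevTracialDesignAPrioriBounds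
open Summit.PneNP.PneNP.Theorems.ChebyshevTracialDesignProfilePolynomial
open Summit.PneNP.PneNP.Theorems.ChebyshevTracialDesignProfileExtrapolation

variable {n : ℕ}

/-! ### §1 Bookkeeping: traces as sums over entry pairs, `t`-cuts as `t`-subsets, Frobenius norms of contractions -/

/-- `tr(X Y) = Σ_{(a,b)} X_{ab} Y_{ba}`. -/
theorem trace_mul_eq_sum_pairs {r : ℕ} (X Y : Matrix (Fin r) (Fin r) ℝ) :
    (X * Y).trace = ∑ ab : Fin r × Fin r, X ab.1 ab.2 * Y ab.2 ab.1 := by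
  rw [Fintype.sum_prod_type]
  simp only [Matrix.trace, Matrix.diag_apply, Matrix.mul_apply]

/-- Re-indexing the odd cuts of size `t` (`t` odd) by the `t`-subsets. -/
theorem sum_oddSet_card_eq {t : ℕ} (ht : Odd t) (F : Finset (Fin n) → ℝ) :
    ∑ U : OddSet n, (if U.1.card = t then F U.1 else 0) = ∑ U ∈ univ.powersetCard t, F U := by
  classical
  rw [← sum_filter]
  have h := sum_oddSet_eq_sum_powersetCard ht (fun _ => True) F
  simp only [and_true, filter_true] at h
  exact h

/-- **Frobenius norm of a contraction**: `Σ_{a,b} A_{ab}² = tr(A²) ≤ tr(A) ≤ r` for `0 ⪯ A ⪯ I_r`. -/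
theorem frobenius_sq_le {r : ℕ} {A : Matrix (Fin r) (Fin r) ℝ} (hA : A.PosSemidef) (h1 : (1 - A).PosSemidef) :
    ∑ a, ∑ b, A a b ^ 2 ≤ (r : ℝ) := by
  have hsym : ∀ a b, A b a = A a b := fun a b => by
    have h := hA.isHermitian.apply a b
    rwa [star_trivial] at h
  have htr : ∑ a, ∑ b, A a b ^ 2 = (A * A).trace := by
    simp only [Matrix.trace, Matrix.diag_apply, Matrix.mul_apply, sq]
    exact sum_congr rfl fun a _ => sum_congr rfl fun b _ => by rw [hsym a b]
  rw [htr]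
  exact (trace_mul_le_trace_left hA h1).trans (trace_le_of_sub_posSemidef h1)

/-- Cauchy–Schwarz for a sum of tails: `Σ_i √(A·u_i·v_i) ≤ √(A·(Σ u_i)·(Σ v_i))` for `A, u_i, v_i ≥ 0`. -/
theorem sum_sqrt_tail_le {ι : Type*} (s : Finset ι) {A : ℝ} (hA : 0 ≤ A) (u v : ι → ℝ) (hu : ∀ i, 0 ≤ u i)
    (hv : ∀ i, 0 ≤ v i) :
    ∑ i ∈ s, Real.sqrt (A * u i * v i) ≤ Real.sqrt (A * (∑ i ∈ s, u i) * ∑ i ∈ s, v i) := by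
  have h1 : ∀ i ∈ s, Real.sqrt (A * u i * v i) = Real.sqrt (A * u i) * Real.sqrt (v i) := fun i _ =>
    Real.sqrt_mul (mul_nonneg hA (hu i)) _
  rw [sum_congr rfl h1]
  refine (Real.sum_sqrt_mul_sqrt_le s (fun i => mul_nonneg hA (hu i)) hv).trans ?_
  rw [← mul_sum, ← Real.sqrt_mul (mul_nonneg hA (sum_nonneg fun i _ => hu i))]

/-! ### §2 The tracial profile polynomial -/

/-- **The tracial profile polynomial.** For `n` even, `t = 2c'+1` with `2t + 2 ≤ n`, `D < t`, and ANY `X : OddSet n → M_r(ℝ)`,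
`Y : PM_n → M_r(ℝ)`: there are harmonic layer data `p_{ab}` of the entries of `X` on the `t`-cuts (`(X_U)_{ab} = (Σ_j (Wᵀ)^{t−j} p_{ab,j})(U)`
for `|U| = t`) and ONE real polynomial `P` of degree `≤ D` such that, with `Q_A = ((Σ_j (t−j)!·[j ≤ D]·p_{ab,j})(A))_{ab}` the matrix
coefficients of the entrywise low part of `X`,
`P(0) = (1/|PM|)·Σ_M Σ_{|A|≤D} tr(Q_A Y_M)·knapsackMoment(|M|, t/2, |M[A]|)` and, at EVERY odd level `c = 2m+1 ≤ t`,
`|Σ_{(U,M)∈Q_c(t)} tr(X_U Y_M) − |Q_c(t)|·P(c)| ≤ |Q_c(t)|·√(P_D·(Σ_{|U|=t} ‖X_U‖_F²/C(n,t))·(Σ_M ‖Y_M‖_F²/|PM|))`,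
`P_D = Π_{i<D/2+1} (2i+1)/(n−2i)`. [cite: Rothvoss2017, §2 (PDF p. 6)] [cite: Grigoriev2001, Lemma 1.4 (PDF p. 8)]
[cite: GriblingDelaatLaurent2019, §5] -/
theorem tracial_profile_polynomial {c' D r : ℕ} (hn : Even n) (ht : 2 * (2 * c' + 1) + 2 ≤ n) (hD : D ≤ 2 * c')
    (X : OddSet n → Matrix (Fin r) (Fin r) ℝ) (Y : PMatch n → Matrix (Fin r) (Fin r) ℝ) :
    ∃ (p : Fin r × Fin r → ℕ → Finset (Fin n) → ℝ) (P : Polynomial ℝ),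
      (∀ ab j, IsHarmonic j (p ab j)) ∧
      (∀ ab (U : OddSet n), U.1.card = 2 * c' + 1 →
        X U ab.1 ab.2 = (∑ j ∈ range (2 * c' + 1 + 1), up^[2 * c' + 1 - j] (p ab j)) U.1) ∧
      P.natDegree ≤ D ∧
      P.eval 0 = (Fintype.card (PMatch n) : ℝ)⁻¹ * ∑ M : PMatch n, ∑ A : {A : Finset (Fin n) // A.card ≤ D},
        (Matrix.of (fun a b : Fin r =>
            (∑ j ∈ range (2 * c' + 1 + 1), ((2 * c' + 1 - j).factorial : ℝ) • (if D < j then 0 else p (a, b) j)) A.1) * Y M).trace *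
          knapsackMoment M.1.card (((2 * c' + 1 : ℕ) : ℝ) / 2) (M.1.filter fun e => ∃ a ∈ A.1, a ∈ e).card ∧
      ∀ m : ℕ, m ≤ c' →
        |∑ q ∈ Qset n (2 * c' + 1) (2 * m + 1), (X q.1 * Y q.2).trace -
            ((Qset n (2 * c' + 1) (2 * m + 1)).card : ℝ) * P.eval ((2 * m + 1 : ℕ) : ℝ)| ≤
          ((Qset n (2 * c' + 1) (2 * m + 1)).card : ℝ) *
            Real.sqrt ((∏ i ∈ range (D / 2 + 1), ((2 * i + 1 : ℝ) / ((n : ℝ) - 2 * i))) *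
              ((∑ U : OddSet n, if U.1.card = 2 * c' + 1 then ∑ a, ∑ b, X U a b ^ 2 else 0) / (n.choose (2 * c' + 1) : ℝ)) *
              ((∑ M : PMatch n, ∑ a, ∑ b, Y M a b ^ 2) / (Fintype.card (PMatch n) : ℝ))) := by
  classical
  have htodd : Odd (2 * c' + 1) := ⟨c', rfl⟩
  have htn : 2 * (2 * c' + 1) ≤ n + 1 := by omega
  -- entry test functions on the `t`-subsets and their weights
  set f : Fin r × Fin r → Finset (Fin n) → ℝ := fun ab U =>
    if h : U.card = 2 * c' + 1 then X ⟨U, ⟨c', h⟩⟩ ab.1 ab.2 else 0 with hf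
  set y : Fin r × Fin r → PMatch n → ℝ := fun ab M => Y M ab.2 ab.1 with hy
  have hhom : ∀ ab, IsHomog (2 * c' + 1) (f ab) := fun ab U hU => by
    simp only [hf, dif_neg hU]
  have hdecomp := fun ab => exists_ladder_decomposition htn (hhom ab)
  choose p hp hpdec using hdecomp
  have hdec : ∀ ab, ∀ U ∈ univ.powersetCard (2 * c' + 1),
      f ab U = (∑ j ∈ range (2 * c' + 1 + 1), up^[2 * c' + 1 - j] (p ab j)) U :=
    fun ab U _ => by rw [← hpdec ab]
  -- per entry pair: the weighted profile polynomial (brick 18)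
  have H := fun ab => weighted_profile_polynomial hn ht hD (f ab) (p ab) (hp ab) (hdec ab) (y ab)
  choose Pab hdeg h0 hlev using H
  have hfX : ∀ ab (U : OddSet n), U.1.card = 2 * c' + 1 → f ab U.1 = X U ab.1 ab.2 := fun ab U hU => by
    simp only [hf, dif_pos hU]
  refine ⟨p, ∑ ab : Fin r × Fin r, Pab ab, hp, fun ab U hU => ?_, ?_, ?_, fun m hmc => ?_⟩
  · rw [← hfX ab U hU, hpdec ab]
  · exact natDegree_sum_le_of_forall_le _ _ fun ab _ => hdeg ab
  · -- `P(0) = (1/|PM|)·Σ_M Σ_A tr(Q_A Y_M)·km`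
    rw [eval_finsetSum, sum_congr rfl fun ab _ => h0 ab, ← mul_sum]
    congr 1
    rw [sum_comm]
    refine sum_congr rfl fun M _ => ?_
    simp only [mul_sum]
    rw [sum_comm]
    refine sum_congr rfl fun A _ => ?_
    rw [trace_mul_eq_sum_pairs, sum_mul]
    refine sum_congr rfl fun ab _ => ?_
    simp only [hy, Matrix.of_apply, Prod.mk.eta]
    ring
  · -- the level sum splits over the entry pairs
    have hΦ : ∑ q ∈ Qset n (2 * c' + 1) (2 * m + 1), (X q.1 * Y q.2).trace =
        ∑ ab : Fin r × Fin r, ∑ M : PMatch n, y ab M * ∑ U ∈ univ.powersetCard (2 * c' + 1),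
          f ab U * (if (U.filter fun x => M.2.partner x ∉ U).card = 2 * m + 1 then (1 : ℝ) else 0) := by
      calc ∑ q ∈ Qset n (2 * c' + 1) (2 * m + 1), (X q.1 * Y q.2).trace
          = ∑ U : OddSet n, ∑ M : PMatch n,
              (if (U, M) ∈ Qset n (2 * c' + 1) (2 * m + 1) then (X U * Y M).trace else 0) :=
            (sum_sum_ite_mem _ fun U M => (X U * Y M).trace).symm
        _ = ∑ U : OddSet n, ∑ M : PMatch n, ∑ ab : Fin r × Fin r,
              (if U.1.card = 2 * c' + 1 ∧ cc U M = 2 * m + 1 then f ab U.1 * y ab M else 0) := by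
            refine sum_congr rfl fun U _ => sum_congr rfl fun M _ => ?_
            simp only [mem_Qset_iff]
            by_cases h : U.1.card = 2 * c' + 1 ∧ cc U M = 2 * m + 1
            · simp only [if_pos h]
              rw [trace_mul_eq_sum_pairs]
              exact sum_congr rfl fun ab _ => by rw [hfX ab U h.1]
            · simp only [if_neg h, sum_const_zero]
        _ = ∑ U : OddSet n, ∑ ab : Fin r × Fin r, ∑ M : PMatch n,
              (if U.1.card = 2 * c' + 1 ∧ cc U M = 2 * m + 1 then f ab U.1 * y ab M else 0) :=
            sum_congr rfl fun U _ => sum_comm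
        _ = ∑ ab : Fin r × Fin r, ∑ U : OddSet n, ∑ M : PMatch n,
              (if U.1.card = 2 * c' + 1 ∧ cc U M = 2 * m + 1 then f ab U.1 * y ab M else 0) := sum_comm
        _ = ∑ ab : Fin r × Fin r, ∑ M : PMatch n, ∑ U : OddSet n,
              (if U.1.card = 2 * c' + 1 ∧ cc U M = 2 * m + 1 then f ab U.1 * y ab M else 0) :=
            sum_congr rfl fun ab _ => sum_comm
        _ = _ := sum_congr rfl fun ab _ => level_sum_product_eq htodd (2 * m + 1) (f ab) (y ab)
    -- the Frobenius sums, re-indexed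
    have hNX : ∑ ab : Fin r × Fin r, ∑ U ∈ univ.powersetCard (2 * c' + 1), f ab U ^ 2 =
        ∑ U : OddSet n, (if U.1.card = 2 * c' + 1 then ∑ a, ∑ b, X U a b ^ 2 else 0) := by
      rw [sum_comm, ← sum_oddSet_card_eq htodd (fun U => ∑ ab : Fin r × Fin r, f ab U ^ 2)]
      refine sum_congr rfl fun U _ => ?_
      split_ifs with hU
      · rw [Fintype.sum_prod_type]
        exact sum_congr rfl fun a _ => sum_congr rfl fun b _ => by rw [hfX (a, b) U hU]
      · rfl
    have hNY : ∑ ab : Fin r × Fin r, ∑ M : PMatch n, y ab M ^ 2 = ∑ M : PMatch n, ∑ a, ∑ b, Y M a b ^ 2 := by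
      rw [sum_comm]
      refine sum_congr rfl fun M _ => ?_
      rw [Fintype.sum_prod_type]
      exact sum_comm
    have hPD : 0 ≤ ∏ i ∈ range (D / 2 + 1), ((2 * i + 1 : ℝ) / ((n : ℝ) - 2 * i)) :=
      prod_atten_nonneg (n := n) (K := D) (by omega)
    rw [hΦ, eval_finsetSum, mul_sum, ← sum_sub_distrib]
    refine (abs_sum_le_sum_abs _ _).trans ((sum_le_sum fun ab _ => hlev ab m hmc).trans ?_)
    rw [← mul_sum]
    refine mul_le_mul_of_nonneg_left ?_ (Nat.cast_nonneg _)
    refine (sum_sqrt_tail_le univ hPD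
      (fun ab => (∑ U ∈ univ.powersetCard (2 * c' + 1), f ab U ^ 2) / (n.choose (2 * c' + 1) : ℝ))
      (fun ab => (∑ M : PMatch n, y ab M ^ 2) / (Fintype.card (PMatch n) : ℝ))
      (fun ab => by positivity) (fun ab => by positivity)).trans ?_
    rw [← sum_div, ← sum_div, hNX, hNY]

/-! ### §3 Contractions: the tail is `|Q_c| · r · √P_D` -/

/-- The Frobenius mass of a family of contractions on the `t`-cuts is at most `r · C(n,t)`. -/
theorem sum_frobenius_cuts_le {t r : ℕ} (ht : Odd t) {X : OddSet n → Matrix (Fin r) (Fin r) ℝ}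
    (hX : ∀ U, (X U).PosSemidef ∧ (1 - X U).PosSemidef) :
    (∑ U : OddSet n, if U.1.card = t then ∑ a, ∑ b, X U a b ^ 2 else 0) ≤ (r : ℝ) * (n.choose t : ℝ) := by
  calc (∑ U : OddSet n, if U.1.card = t then ∑ a, ∑ b, X U a b ^ 2 else 0)
      ≤ ∑ U : OddSet n, (if U.1.card = t then (r : ℝ) else 0) := by
        refine sum_le_sum fun U _ => ?_
        split_ifs
        · exact frobenius_sq_le (hX U).1 (hX U).2
        · exact le_rfl
    _ = (r : ℝ) * (n.choose t : ℝ) := by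
        rw [sum_oddSet_card_eq ht (fun _ => (r : ℝ)), sum_const, card_powersetCard, card_univ, Fintype.card_fin,
          nsmul_eq_mul, mul_comm]

/-- The Frobenius mass of a family of contractions on the perfect matchings is at most `r · |PM_n|`. -/
theorem sum_frobenius_matchings_le {r : ℕ} {Y : PMatch n → Matrix (Fin r) (Fin r) ℝ}
    (hY : ∀ M, (Y M).PosSemidef ∧ (1 - Y M).PosSemidef) :
    ∑ M : PMatch n, ∑ a, ∑ b, Y M a b ^ 2 ≤ (r : ℝ) * (Fintype.card (PMatch n) : ℝ) := by
  calc ∑ M : PMatch n, ∑ a, ∑ b, Y M a b ^ 2 ≤ ∑ _M : PMatch n, (r : ℝ) :=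
        sum_le_sum fun M _ => frobenius_sq_le (hY M).1 (hY M).2
    _ = (r : ℝ) * (Fintype.card (PMatch n) : ℝ) := by rw [sum_const, card_univ, nsmul_eq_mul, mul_comm]

/-- The normalised tail for contractions: `√(P_D · (N_X/C(n,t)) · (N_Y/|PM|)) ≤ r · √P_D` when `N_X ≤ r·C(n,t)`, `N_Y ≤ r·|PM|`. -/
theorem sqrt_tail_le_of_le {PD NX NY Cn Pm r : ℝ} (hPD : 0 ≤ PD) (hCn : 0 < Cn) (hPm : 0 < Pm) (hr : 0 ≤ r)
    (hNY0 : 0 ≤ NY) (hNX : NX ≤ r * Cn) (hNY : NY ≤ r * Pm) :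
    Real.sqrt (PD * (NX / Cn) * (NY / Pm)) ≤ r * Real.sqrt PD := by
  have h1 : NX / Cn ≤ r := (div_le_iff₀ hCn).2 hNX
  have h2 : NY / Pm ≤ r := (div_le_iff₀ hPm).2 hNY
  calc Real.sqrt (PD * (NX / Cn) * (NY / Pm)) ≤ Real.sqrt (PD * r * r) :=
        Real.sqrt_le_sqrt (mul_le_mul (mul_le_mul_of_nonneg_left h1 hPD) h2 (div_nonneg hNY0 hPm.le) (by positivity))
    _ = r * Real.sqrt PD := by
        rw [mul_assoc, Real.sqrt_mul hPD, Real.sqrt_mul_self hr, mul_comm]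

/-- **The tracial profile polynomial of a pair of contraction families** (`0 ⪯ X_U ⪯ I_r`, `0 ⪯ Y_M ⪯ I_r`; tightness is NOT used):
as `tracial_profile_polynomial`, with the tail `|Q_c(t)| · r · √P_D` at every odd level — i.e. `|levelProfile(c) − P(c)/r| ≤ √P_D`.
[cite: Rothvoss2017, §2 (PDF p. 6)] [cite: GriblingDelaatLaurent2019, §5] -/
theorem tracial_profile_polynomial_of_contractions {c' D r : ℕ} (hn : Even n) (ht : 2 * (2 * c' + 1) + 2 ≤ n) (hD : D ≤ 2 * c')
    (X : OddSet n → Matrix (Fin r) (Fin r) ℝ) (Y : PMatch n → Matrix (Fin r) (Fin r) ℝ)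
    (hX : ∀ U, (X U).PosSemidef ∧ (1 - X U).PosSemidef) (hY : ∀ M, (Y M).PosSemidef ∧ (1 - Y M).PosSemidef) :
    ∃ (p : Fin r × Fin r → ℕ → Finset (Fin n) → ℝ) (P : Polynomial ℝ),
      (∀ ab j, IsHarmonic j (p ab j)) ∧
      (∀ ab (U : OddSet n), U.1.card = 2 * c' + 1 →
        X U ab.1 ab.2 = (∑ j ∈ range (2 * c' + 1 + 1), up^[2 * c' + 1 - j] (p ab j)) U.1) ∧
      P.natDegree ≤ D ∧
      P.eval 0 = (Fintype.card (PMatch n) : ℝ)⁻¹ * ∑ M : PMatch n, ∑ A : {A : Finset (Fin n) // A.card ≤ D},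
        (Matrix.of (fun a b : Fin r =>
            (∑ j ∈ range (2 * c' + 1 + 1), ((2 * c' + 1 - j).factorial : ℝ) • (if D < j then 0 else p (a, b) j)) A.1) * Y M).trace *
          knapsackMoment M.1.card (((2 * c' + 1 : ℕ) : ℝ) / 2) (M.1.filter fun e => ∃ a ∈ A.1, a ∈ e).card ∧
      ∀ m : ℕ, m ≤ c' →
        |∑ q ∈ Qset n (2 * c' + 1) (2 * m + 1), (X q.1 * Y q.2).trace -
            ((Qset n (2 * c' + 1) (2 * m + 1)).card : ℝ) * P.eval ((2 * m + 1 : ℕ) : ℝ)| ≤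
          ((Qset n (2 * c' + 1) (2 * m + 1)).card : ℝ) *
            ((r : ℝ) * Real.sqrt (∏ i ∈ range (D / 2 + 1), ((2 * i + 1 : ℝ) / ((n : ℝ) - 2 * i)))) := by
  obtain ⟨p, P, hp, hpdec, hdeg, h0, hlev⟩ := tracial_profile_polynomial hn ht hD X Y
  refine ⟨p, P, hp, hpdec, hdeg, h0, fun m hmc => (hlev m hmc).trans (mul_le_mul_of_nonneg_left ?_ (Nat.cast_nonneg _))⟩
  have hPm : (0 : ℝ) < Fintype.card (PMatch n) := by exact_mod_cast card_pmatch_pos hn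
  have hCn : (0 : ℝ) < n.choose (2 * c' + 1) := by exact_mod_cast Nat.choose_pos (by omega)
  exact sqrt_tail_le_of_le (prod_atten_nonneg (n := n) (K := D) (by omega)) hCn hPm (Nat.cast_nonneg r)
    (sum_nonneg fun M _ => by positivity) (sum_frobenius_cuts_le ⟨c', rfl⟩ hX) (sum_frobenius_matchings_le hY)

/-! ### §4 An exact design reads off `P(0)`: the tracial degree-truncation theorem with explicit tail -/

/-- Level sums over the odd cuts as sums over the level class `Q_c(t)`. -/
theorem level_sum_eq_sum_Qset (t c : ℕ) (g : OddSet n → PMatch n → ℝ) :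
    ∑ M : PMatch n, ∑ U : OddSet n, (if U.1.card = t ∧ cc U M = c then g U M else 0) = ∑ q ∈ Qset n t c, g q.1 q.2 := by
  classical
  rw [sum_comm, ← sum_sum_ite_mem (Qset n t c) g]
  simp only [mem_Qset_iff]

/-- **The tracial degree-truncation theorem with explicit tail.** For `n` even, an exact design `(n, t = 2c'+1, T, D, B, C, w)` with
`D < t` and ANY `X : OddSet n → M_r(ℝ)`, `Y : PM_n → M_r(ℝ)`: with `p` harmonic layer data of the entries of `X` on the `t`-cuts and
`Q_A` the matrix coefficients of its entrywise low part,
`|Σ_U Σ_M levelWeight(U,M)·tr(X_U Y_M) + (1/|PM|)·Σ_M Σ_{|A|≤D} tr(Q_A Y_M)·knapsackMoment(|M|, t/2, |M[A]|)|`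
`≤ (Σ_{c∈C} |w_c|) · √(P_D · (Σ_{|U|=t} ‖X_U‖_F²/C(n,t)) · (Σ_M ‖Y_M‖_F²/|PM|))` — the design value of every matrix-valued strategy is
minus the averaged Grigoriev pseudo-expectation of `tr(X^{≤D}_U Y_M)`, up to the explicit tail.
[cite: Rothvoss2017, §2 (PDF p. 6)] [cite: Grigoriev2001, Lemma 1.4 (PDF p. 8)] [cite: GriblingDelaatLaurent2019, §5] -/
theorem tracial_value_truncation_explicit {c' T D r : ℕ} {Bv : ℝ} {C : Finset ℕ} {w : ℕ → ℝ} (hn : Even n)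
    (hdes : IsExactDesign n (2 * c' + 1) T D Bv C w) (hD : D ≤ 2 * c')
    (X : OddSet n → Matrix (Fin r) (Fin r) ℝ) (Y : PMatch n → Matrix (Fin r) (Fin r) ℝ) :
    ∃ p : Fin r × Fin r → ℕ → Finset (Fin n) → ℝ,
      (∀ ab j, IsHarmonic j (p ab j)) ∧
      (∀ ab (U : OddSet n), U.1.card = 2 * c' + 1 →
        X U ab.1 ab.2 = (∑ j ∈ range (2 * c' + 1 + 1), up^[2 * c' + 1 - j] (p ab j)) U.1) ∧
      |∑ U : OddSet n, ∑ M : PMatch n, levelWeight n (2 * c' + 1) C w U M * (X U * Y M).trace +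
          (Fintype.card (PMatch n) : ℝ)⁻¹ * ∑ M : PMatch n, ∑ A : {A : Finset (Fin n) // A.card ≤ D},
            (Matrix.of (fun a b : Fin r =>
              (∑ j ∈ range (2 * c' + 1 + 1), ((2 * c' + 1 - j).factorial : ℝ) • (if D < j then 0 else p (a, b) j)) A.1) *
                Y M).trace *
              knapsackMoment M.1.card (((2 * c' + 1 : ℕ) : ℝ) / 2) (M.1.filter fun e => ∃ a ∈ A.1, a ∈ e).card| ≤
        (∑ c ∈ C, |w c|) *
          Real.sqrt ((∏ i ∈ range (D / 2 + 1), ((2 * i + 1 : ℝ) / ((n : ℝ) - 2 * i))) *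
            ((∑ U : OddSet n, if U.1.card = 2 * c' + 1 then ∑ a, ∑ b, X U a b ^ 2 else 0) / (n.choose (2 * c' + 1) : ℝ)) *
            ((∑ M : PMatch n, ∑ a, ∑ b, Y M a b ^ 2) / (Fintype.card (PMatch n) : ℝ))) := by
  classical
  have ht : 2 * (2 * c' + 1) + 2 ≤ n := hdes.2.1
  have hC := hdes.2.2.2.1
  have hexact := hdes.2.2.2.2.2.1
  obtain ⟨p, P, hp, hpdec, hdeg, h0, hlev⟩ := tracial_profile_polynomial hn ht hD X Y
  refine ⟨p, hp, hpdec, ?_⟩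
  rw [← h0]
  set τ : ℝ := Real.sqrt ((∏ i ∈ range (D / 2 + 1), ((2 * i + 1 : ℝ) / ((n : ℝ) - 2 * i))) *
    ((∑ U : OddSet n, if U.1.card = 2 * c' + 1 then ∑ a, ∑ b, X U a b ^ 2 else 0) / (n.choose (2 * c' + 1) : ℝ)) *
    ((∑ M : PMatch n, ∑ a, ∑ b, Y M a b ^ 2) / (Fintype.card (PMatch n) : ℝ))) with hτ
  set Φ : ℕ → ℝ := fun c => ∑ q ∈ Qset n (2 * c' + 1) c, (X q.1 * Y q.2).trace with hΦ
  have hval : ∑ U : OddSet n, ∑ M : PMatch n, levelWeight n (2 * c' + 1) C w U M * (X U * Y M).trace =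
      ∑ c ∈ C, w c / ((Qset n (2 * c' + 1) c).card : ℝ) * Φ c := by
    rw [value_eq_level_sums]
    exact sum_congr rfl fun c _ => by rw [level_sum_eq_sum_Qset]
  have hlevC : ∀ c ∈ C, |w c / ((Qset n (2 * c' + 1) c).card : ℝ) * Φ c - w c * P.eval (c : ℝ)| ≤ |w c| * τ := by
    intro c hc
    obtain ⟨⟨m, hm⟩, -, -, hne⟩ := hC c hc
    have hmc : m ≤ c' := by have := hdes.2.2.1; have := (hC c hc).2.2.1; omega
    have hQpos : (0 : ℝ) < ((Qset n (2 * c' + 1) c).card : ℝ) := by exact_mod_cast card_pos.2 hne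
    have h1 : |Φ c - ((Qset n (2 * c' + 1) c).card : ℝ) * P.eval (c : ℝ)| ≤ ((Qset n (2 * c' + 1) c).card : ℝ) * τ := by
      have h0' := hlev m hmc
      rw [← hm] at h0'
      simpa only [hΦ] using h0'
    have heq : w c / ((Qset n (2 * c' + 1) c).card : ℝ) * Φ c - w c * P.eval (c : ℝ) =
        w c / ((Qset n (2 * c' + 1) c).card : ℝ) * (Φ c - ((Qset n (2 * c' + 1) c).card : ℝ) * P.eval (c : ℝ)) := by
      field_simp
    rw [heq, abs_mul, abs_div, Nat.abs_cast]
    calc |w c| / ((Qset n (2 * c' + 1) c).card : ℝ) * |Φ c - ((Qset n (2 * c' + 1) c).card : ℝ) * P.eval (c : ℝ)|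
        ≤ |w c| / ((Qset n (2 * c' + 1) c).card : ℝ) * (((Qset n (2 * c' + 1) c).card : ℝ) * τ) :=
          mul_le_mul_of_nonneg_left h1 (div_nonneg (abs_nonneg _) hQpos.le)
      _ = |w c| * τ := by field_simp
  have hsum : ∑ U : OddSet n, ∑ M : PMatch n, levelWeight n (2 * c' + 1) C w U M * (X U * Y M).trace + P.eval 0 =
      ∑ c ∈ C, (w c / ((Qset n (2 * c' + 1) c).card : ℝ) * Φ c - w c * P.eval (c : ℝ)) := by
    rw [hval, sum_sub_distrib, hexact P hdeg]
    ring
  rw [hsum, sum_mul]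
  exact (abs_sum_le_sum_abs _ _).trans (sum_le_sum hlevC)

/-! ### §5 The two-layer plan at every dimension: virtual nonnegativity implies tracial decay -/

/-- **Virtual nonnegativity ⇒ tracial value bound, at every dimension `r`.** For `n` even, an exact design
`(n, t = 2c'+1, T, D, B, C, w)` with `D < t`, and `r > 0`: if for EVERY tight-orthogonal psd rectangle `(X, Y)` of dimension `r`
(`IsPsdRect X Y`) and every harmonic layer data `p` of the entries of `X` on the `t`-cuts, the averaged Grigoriev pseudo-expectation of
the entrywise low part satisfies `(1/|PM|)·Σ_M Σ_{|A|≤D} tr(Q_A Y_M)·knapsackMoment(|M|, t/2, |M[A]|) ≥ −ε·r`, then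
`TracialValueLEAt (levelWeight n t C w) (ε + B·√P_D) r`, `P_D = Π_{i<D/2+1} (2i+1)/(n−2i)` — the route's (ATT ⇒ VIRT ⇒ decay)
plan with (ATT) discharged, at every dimension. [cite: Rothvoss2017, §2 (PDF p. 6)] [cite: Grigoriev2001, Lemma 1.4 (PDF p. 8)]
[cite: GriblingDelaatLaurent2019, §5] -/
theorem tracialValueLEAt_of_virtualNonneg {c' T D r : ℕ} {Bv ε : ℝ} {C : Finset ℕ} {w : ℕ → ℝ} (hn : Even n)
    (hdes : IsExactDesign n (2 * c' + 1) T D Bv C w) (hD : D ≤ 2 * c') (hr : 0 < r)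
    (hvirt : ∀ (X : OddSet n → Matrix (Fin r) (Fin r) ℝ) (Y : PMatch n → Matrix (Fin r) (Fin r) ℝ), IsPsdRect X Y →
      ∀ p : Fin r × Fin r → ℕ → Finset (Fin n) → ℝ, (∀ ab j, IsHarmonic j (p ab j)) →
        (∀ ab (U : OddSet n), U.1.card = 2 * c' + 1 →
          X U ab.1 ab.2 = (∑ j ∈ range (2 * c' + 1 + 1), up^[2 * c' + 1 - j] (p ab j)) U.1) →
        -(ε * r) ≤ (Fintype.card (PMatch n) : ℝ)⁻¹ * ∑ M : PMatch n, ∑ A : {A : Finset (Fin n) // A.card ≤ D},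
          (Matrix.of (fun a b : Fin r =>
            (∑ j ∈ range (2 * c' + 1 + 1), ((2 * c' + 1 - j).factorial : ℝ) • (if D < j then 0 else p (a, b) j)) A.1) *
              Y M).trace *
            knapsackMoment M.1.card (((2 * c' + 1 : ℕ) : ℝ) / 2) (M.1.filter fun e => ∃ a ∈ A.1, a ∈ e).card) :
    TracialValueLEAt (levelWeight n (2 * c' + 1) C w)
      (ε + Bv * Real.sqrt (∏ i ∈ range (D / 2 + 1), ((2 * i + 1 : ℝ) / ((n : ℝ) - 2 * i)))) r := by
  intro X Y hrect
  have ht : 2 * (2 * c' + 1) + 2 ≤ n := hdes.2.1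
  have hB := hdes.2.2.2.2.2.2
  obtain ⟨p, hp, hpdec, hbound⟩ := tracial_value_truncation_explicit hn hdes hD X Y
  have hv := hvirt X Y hrect p hp hpdec
  have hPm : (0 : ℝ) < Fintype.card (PMatch n) := by exact_mod_cast card_pmatch_pos hn
  have hCn : (0 : ℝ) < n.choose (2 * c' + 1) := by exact_mod_cast Nat.choose_pos (by omega)
  have hPD := prod_atten_nonneg (n := n) (K := D) (by omega)
  have htail := sqrt_tail_le_of_le hPD hCn hPm (Nat.cast_nonneg r)
    (sum_nonneg fun M _ => by positivity) (sum_frobenius_cuts_le ⟨c', rfl⟩ hrect.1)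
    (sum_frobenius_matchings_le hrect.2.1)
  have hw0 : 0 ≤ ∑ c ∈ C, |w c| := sum_nonneg fun c _ => abs_nonneg _
  have hr' : (0 : ℝ) < r := by exact_mod_cast hr
  rw [div_le_iff₀ hr']
  have h1 := (abs_le.1 hbound).2
  have h2 : (∑ c ∈ C, |w c|) *
      Real.sqrt ((∏ i ∈ range (D / 2 + 1), ((2 * i + 1 : ℝ) / ((n : ℝ) - 2 * i))) *
        ((∑ U : OddSet n, if U.1.card = 2 * c' + 1 then ∑ a, ∑ b, X U a b ^ 2 else 0) / (n.choose (2 * c' + 1) : ℝ)) *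
        ((∑ M : PMatch n, ∑ a, ∑ b, Y M a b ^ 2) / (Fintype.card (PMatch n) : ℝ))) ≤
      Bv * ((r : ℝ) * Real.sqrt (∏ i ∈ range (D / 2 + 1), ((2 * i + 1 : ℝ) / ((n : ℝ) - 2 * i)))) :=
    mul_le_mul hB htail (Real.sqrt_nonneg _) (hw0.trans hB)
  nlinarith [h1, h2, hv]

end Summit.PneNP.PneNP.Theorems.ChebyshevTracialDesignTracialProfilePolynomial
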